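import Literature.NumberTheory.EllipticCurves.TorsionFrobeniusProofs
import Literature.AlgebraicGeometry.Motives.ZetaFunctionProofs
import Literature.NumberTheory.GaloisRepresentations.TransvectionCriterionGL2FpProofs
import Summits.BirchSwinnertonDyer.BirchSwinnertonDyer.Theorems.Rank1ResidualIntModelSurjectivity
import HarnessLib

/-!
# BSD rank-≤1 residual cell: SURJECTIVITY of `ρ̄_{E,p}` from TWO Frobenius witnesses — one with
# irreducible characteristic polynomial, one OF ORDER `p` — read off an integer model (any prime `p`,
# in particular `p = 3`, where Serre's Prop. 19 is not available)

HONEST FRAMING (cell `b2b-bsdres-*`, run/shared/lean/b2b/bsd-rank1-residual/, verbatim): the goal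
of the cell is to DELETE the COMBINATION-SHAPED residual classes for ALL analytic-rank `≤ 1` elliptic
curves over `ℚ` — "full BSD formula for every rank `≤ 1` curve in class C" assembled STRICTLY from
published theorems — so that the rank-`≤ 1` remainder becomes exactly the CONSTRUCTION-SHAPED
classes, which are TYPED (missing-input Props), NOT attempted; this is not "finishing BSD".
Prove what is provable now; shrink each hard class to its core with data; no claim beyond stated
classes. Unit `b2b-bsdres-x11c` (gen 6). Theorems only (no definition, no named fact); a TOOL file:
nothing here is a class theorem and no label changes.

## What this file does

The cell's per-pair certificates need `Surj W p` (`ρ̄_{E,p} : Γ_ℚ → Aut(E[p])` onto) as a KERNEL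
theorem. For `p ≥ 5` the companion `Theorems/Rank1ResidualIntModelSurjectivity.lean` reads Serre's
three witnesses (Invent. Math. 15 (1972) §2.8 Prop. 19) off kernel point counts. Prop. 19 needs
`p ≥ 5`; at `p = 3` (every open rank-one pair with `9 ∣ #Ш_an` of the visibility census, HOME
b2b-bsdres-hyp/hyp/vis/VISIBILITY-FILTER.md) the images of `GL₂(𝔽₃)` with surjective determinant
and no invariant line that are NOT everything are exactly the `2`-groups (inside a normaliser of a
Cartan subgroup), so what must be certified is an element of ORDER `p` in the image. A Frobenius
conjugacy class (trace, determinant) cannot see this (the identity and a transvection share the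
characteristic polynomial `(X − 1)²`); the reduction of torsion can:

* `sq_dvd_reductionPointCount_of_forall_smul_eq` — **if an arithmetic Frobenius `φ` at a prime
  above a good `ℓ ≠ p` acts TRIVIALLY on `E[p]`, then `p² ∣ #Ẽ(𝔽_ℓ)`**: the reduction map on
  `p`-primary torsion `E(ℚ̄)[p^∞] → Ẽ(𝔽̄_ℓ)` along an embedding `ℚ̄ → ℚ̄_ℓ`
  (`WeierstrassCurve.exists_reduceTorsionHom`: Silverman AEC VII.2.1, injective by VII.3.1(b),
  intertwining a local Frobenius with `x ↦ x^ℓ`) sends `E[p]` (`p²` points, AEC III.6.4(b)) to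
  points FIXED by the `ℓ`-power Frobenius, i.e. to `𝔽_ℓ`-rational points
  (`exists_baseChange_eq_of_frobenius_smul_eq`: a point of `Ẽ(𝔽̄_ℓ)` fixed by `x ↦ x^ℓ` has
  coordinates among the `ℓ` roots of `T^ℓ − T`, the tree's `mem_range_of_pow_card_eq`), giving an
  injective homomorphism `E[p] ↪ Ẽ(𝔽_ℓ)`, so `p² ∣ #Ẽ(𝔽_ℓ)` (Lagrange); the passage between the
  given `(𝔓, φ)` and the Frobenius of the embedding is by conjugation and the triviality of inertia
  on `E[p]` at a good `ℓ ∤ p` (AEC VII.4.1(a)), word for word as in the tree's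
  `exists_frobenius_smul_eq_of_dvd_reductionPointCount_holds` (`TorsionFrobeniusProofs`);
* `hasSurjectiveModNGaloisRep_of_irr_of_order` — **`ρ̄_{E,p}` is onto** as soon as (i) some good
  `ℓ₁ ≠ p` has `X² − a_{ℓ₁}X + ℓ₁` irreducible mod `p` (so the image lies in no Borel subgroup) and
  (ii) some good `ℓ₂ ≠ p` has `ℓ₂ ≡ 1`, `a_{ℓ₂} ≡ 2 (mod p)` and `p² ∤ #Ẽ(𝔽_{ℓ₂})`: by (ii) and the
  first theorem the framed Frobenius `g = Φ(ρ̄(φ_{ℓ₂}))` has `det g = 1`, `det(g − 1) = 0`, `g ≠ 1`,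
  hence order `p` (tree: `Serre1972.orderOf_eq_of_det_eq_one_of_det_sub_one_eq_zero`, a
  transvection), so `p ∣ #G`; Serre's Prop. 15 (tree: `eq_top_of_dvd_card_of_forall_ne`) with the
  irreducible element of (i) and `det = χ̄_p` onto (`exists_frame_galoisRepTorsion_rat`, §5.2 (iii))
  gives `G = GL₂(𝔽_p)`, i.e. `Surj` (`map_range_galoisRepTorsion_eq_top_iff`);
* `hasSurjectiveModNGaloisRep_of_intModel_of_irr_of_order` — the same READ OFF AN INTEGER MODEL
  `integralModelInt W = E₀`: `ℓᵢ ∤ Δ(E₀)`, kernel point counts `#(E₀ mod ℓᵢ)(𝔽_{ℓᵢ}) = nᵢ`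
  (`a_{ℓᵢ} = ℓᵢ + 1 − nᵢ`, `#Ẽ(𝔽_{ℓ₂}) = n₂` by `reductionPointCount_eq_of_intModel`), the
  conditions being decidable statements in `ZMod p` and `ℕ`.

At `p = 3` condition (ii) reads: `ℓ₂ ≡ 1 (mod 3)`, `3 ∣ n₂`, `9 ∤ n₂`. Used by the per-pair rank-one
visibility certificates `Rank1Residual/Visibility/RankOnePairs*.lean` (unit x11c gen 6) and usable
by every consumer of `Surj W 3` in the cell (X10a′, X4 ∧ p = 3, X11b ∧ p = 3).

References: J.-P. Serre, Invent. Math. 15 (1972) §2.4 Prop. 15, §2.8, §4.2, §5.2 (iii) [Serre1972];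
J. H. Silverman, AEC 2nd ed. (2009) Prop. VII.2.1, VII.3.1(b), VII.4.1(a), Cor. III.6.4(b)
[SilvermanAEC2009]; B. Mazur, Invent. Math. 44 (1978) Prop. 6.3 (1) [Mazur1978].
-/

noncomputable section

open scoped Classical MatrixGroups
open NumberField IsDedekindDomain IsDedekindDomain.HeightOneSpectrum Field WeierstrassCurve
  Literature.NumberTheory.EllipticCurves Literature.NumberTheory.GaloisRepresentations
  Literature.NumberTheory.GaloisRepresentations.Serre1972
  Summit.BirchSwinnertonDyer.BirchSwinnertonDyer.Rank1Residual.IntModel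

namespace Summit.BirchSwinnertonDyer.Rank1Residual.GaloisImage

universe u

/-- **A point of `V(k̄)` fixed by the `#k`-power Frobenius of a finite field `k` is `k`-rational**: its
coordinates satisfy `x ^ #k = x`, so lie among the `#k` roots of `T^{#k} − T`, which are the image of
`k` (tree `Literature.AlgebraicGeometry.Motives.mem_range_of_pow_card_eq`); the point `O` is
`baseChange O`. (Silverman AEC I.§1 / V.§1: `V(k) = V(k̄)^{Frob}` for a finite field.)
[cite: SilvermanAEC2009, I.§1 and VIII.§1 (proof of Prop. 1.2)] -/
theorem exists_baseChange_eq_of_frobenius_smul_eq {k : Type u} [Field k] [Finite k]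
    (V : WeierstrassCurve k) {φ : absoluteGaloisGroup k}
    (hφ : ∀ x : AlgebraicClosure k, φ • x = x ^ Nat.card k)
    {R : geomPoints V} (hR : φ • R = R) :
    ∃ R₀ : (V.baseChange k).toAffine.Point, Affine.Point.baseChange k (AlgebraicClosure k) R₀ = R := by
  change (V.baseChange (AlgebraicClosure k)).toAffine.Point at R
  rcases R with _ | ⟨x, y, h⟩
  · exact ⟨0, rfl⟩
  · set φ' : AlgebraicClosure k ≃ₐ[k] AlgebraicClosure k := φ with hφ'
    have hxy : φ' x = x ∧ φ' y = y := by
      have := hR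
      change Affine.Point.map (φ' : AlgebraicClosure k →ₐ[k] AlgebraicClosure k)
        (Affine.Point.some x y h) = Affine.Point.some x y h at this
      rw [Affine.Point.map_some] at this
      simpa only [Affine.Point.some.injEq, AlgEquiv.coe_toAlgHom] using this
    have hx : x ∈ Set.range (algebraMap k (AlgebraicClosure k)) := by
      refine Literature.AlgebraicGeometry.Motives.mem_range_of_pow_card_eq
        (algebraMap k (AlgebraicClosure k)) ?_
      rw [← hφ x]; exact hxy.1
    have hy : y ∈ Set.range (algebraMap k (AlgebraicClosure k)) := by
      refine Literature.AlgebraicGeometry.Motives.mem_range_of_pow_card_eq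
        (algebraMap k (AlgebraicClosure k)) ?_
      rw [← hφ y]; exact hxy.2
    obtain ⟨x₀, rfl⟩ := hx
    obtain ⟨y₀, rfl⟩ := hy
    have h₀ : (V.baseChange k).toAffine.Nonsingular x₀ y₀ :=
      (Affine.baseChange_nonsingular V (Algebra.ofId k (AlgebraicClosure k)).injective x₀ y₀).mp h
    exact ⟨Affine.Point.some x₀ y₀ h₀, rfl⟩

/-- **An arithmetic Frobenius at a good prime `ℓ ≠ p` acting TRIVIALLY on `E[p]` forces
`p² ∣ #Ẽ(𝔽_ℓ)`.** Let `E = W/ℚ` be an elliptic curve in global minimal form, `p`, `ℓ ≠ p` primes,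
`W` with good reduction at `ℓ`, `v ∋ ℓ` the place, `𝔓` a prime of `\bar ℤ` above `v`, `φ ∈ Γ_ℚ` an
arithmetic Frobenius at `𝔓` with `φ P = P` for every `P ∈ E[p]`. Then `p² ∣ #Ẽ(𝔽_ℓ) =
W.reductionPointCount ℓ`. Proof: the Frobenius `σ₀ = σ_v|_{ℚ̄}` of the embedding `ι : ℚ̄ → ℚ̄_v`
also fixes `E[p]` (it is `τ⁻¹ γ τ` with `γ = τ σ₀ τ⁻¹` a Frobenius at `𝔓`, and `γ = i φ` with
`i ∈ I_𝔓` acting trivially on `E[p]`, AEC VII.4.1(a), `smul_eq_of_mem_inertia_of_nsmul_eq_zero`);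
the reduction map `f : E(ℚ̄)[p^∞] → Ẽ_v(\bar k_v)` (`exists_reduceTorsionHom`, AEC VII.2.1 /
VII.3.1(b), injective, `f (σ₀ P) = Frob_ℓ (f P)`) therefore lands, on `E[p]`, in the points fixed by
`x ↦ x^ℓ`, which are `k_v`-rational (`exists_baseChange_eq_of_frobenius_smul_eq`); this is an
injective homomorphism `E[p] ↪ Ẽ_v(k_v)` from a group of order `p²` (AEC III.6.4(b),
`card_torsionPoints_eq_sq_holds`) into a group of order `#Ẽ(𝔽_ℓ)`
(`natCard_point_reduction_minimal_baseChange`, AEC VII.1.3(b)); Lagrange.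
[cite: SilvermanAEC2009, Prop. VII.3.1(b) (PDF p. 170), Prop. VII.2.1, proof of Prop. VII.4.1(a) (PDF p. 173), Cor. III.6.4(b)] -/
theorem sq_dvd_reductionPointCount_of_forall_smul_eq (W : WeierstrassCurve ℚ) [W.IsElliptic]
    [W.IsGloballyMinimal] (p ℓ : ℕ) [Fact p.Prime] [Fact ℓ.Prime] (hℓp : ℓ ≠ p)
    (hgoodℓ : W.HasGoodReductionAtPrime ℓ) {v : HeightOneSpectrum (𝓞 ℚ)}
    (hv : (ℓ : 𝓞 ℚ) ∈ v.asIdeal) {𝔓 : Ideal (absIntegers (𝓞 ℚ) ℚ)} (h𝔓 : 𝔓 ∈ v.primesAbove)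
    {φ : absoluteGaloisGroup ℚ} (hφ : IsArithFrobAt (𝓞 ℚ) φ 𝔓)
    (hfix : ∀ P : W.geomTorsion p, φ • P = P) :
    p ^ 2 ∣ W.reductionPointCount ℓ := by
  classical
  have hp : p.Prime := Fact.out
  have hℓ : ℓ.Prime := Fact.out
  -- Step 0: from the rational prime `ℓ` to the place `v`
  have hvℓ : (Rat.HeightOneSpectrum.primesEquiv v : ℕ) = ℓ := primesEquiv_eq_of_natCast_mem hℓ hv
  have hgood : W.HasGoodReductionAt v :=
    (hasGoodReductionAtPrime_primesEquiv_iff_holds W v ℓ hvℓ).mp hgoodℓ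
  have hpv : (p : 𝓞 ℚ) ∉ v.asIdeal := fun h ↦
    hℓp (hvℓ.symm.trans (primesEquiv_eq_of_natCast_mem hp h))
  -- the reduction `Ẽ_v / k_v`
  set k := IsLocalRing.ResidueField (v.adicCompletionIntegers ℚ) with hk
  set Wt : WeierstrassCurve k := W.reductionAt v with hWt
  haveI : Wt.IsElliptic := isElliptic_reductionAt hgood
  have hWtk : Wt.baseChange k = Wt := by
    rw [baseChange, Algebra.algebraMap_self, map_id]
  have hcard : Nat.card (Wt.baseChange k).toAffine.Point = W.reductionPointCount ℓ := by
    rw [hWtk, ← hvℓ]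
    exact natCard_point_reduction_minimal_baseChange v W
  -- the reduction map on `p`-primary torsion along `ι`, for a local Frobenius `σ_v`
  obtain ⟨𝔐, h𝔐⟩ := v.localPrimesAbove_nonempty
  let ι : AlgebraicClosure ℚ →ₐ[ℚ] AlgebraicClosure (v.adicCompletion ℚ) :=
    closureEmb (K := ℚ) (v.adicCompletion ℚ)
  obtain ⟨σL, hσL⟩ := v.exists_isArithFrobAt_localAbsIntegers h𝔐
  obtain ⟨φk, hφk⟩ := exists_frobenius_absoluteGaloisGroup k
  obtain ⟨f, hf, hfσ⟩ := exists_reduceTorsionHom hpv hgood h𝔐 ι hσL hφk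
  set σ₀ : absoluteGaloisGroup ℚ := resGalOfEmb ι σL with hσ₀
  -- transport: `σ₀` also acts trivially on `E[p]`
  have h𝔓₀ : v.primeBelow ι 𝔐 ∈ v.primesAbove := primeBelow_mem_primesAbove h𝔐
  have hσ₀F : IsArithFrobAt (𝓞 ℚ) σ₀ (v.primeBelow ι 𝔐) := isArithFrobAt_resGalOfEmb h𝔐 ι hσL
  obtain ⟨τ, hτ⟩ := exists_smul_eq_of_mem_primesAbove_holds h𝔓₀ h𝔓
  have hγ : IsArithFrobAt (𝓞 ℚ) (τ * σ₀ * τ⁻¹) 𝔓 := hτ ▸ hσ₀F.conj τ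
  have hI : φ * (τ * σ₀ * τ⁻¹)⁻¹ ∈ 𝔓.inertia (absoluteGaloisGroup ℚ) := hφ.mul_inv_mem_inertia hγ
  have hfixpt : ∀ X : geomPoints W, p • X = 0 → φ • X = X := fun X hX ↦ by
    have := congrArg Subtype.val (hfix ⟨X, AddSubgroup.torsionBy.nsmul_iff.mpr hX⟩)
    rwa [AddSubgroup.torsionBy.coe_smul] at this
  have hγfix : ∀ X : geomPoints W, p • X = 0 → (τ * σ₀ * τ⁻¹) • X = X := fun X hX ↦ by
    -- `γ = (φ γ⁻¹)⁻¹ φ`, and the inertia element acts trivially on `p`-torsion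
    have h1 : (τ * σ₀ * τ⁻¹) • X = (φ * (τ * σ₀ * τ⁻¹)⁻¹)⁻¹ • (φ • X) := by
      rw [← mul_smul, mul_inv_rev, inv_inv, inv_mul_cancel_right]
    rw [h1, hfixpt X hX]
    exact W.smul_eq_of_mem_inertia_of_nsmul_eq_zero hgood hpv h𝔓 (inv_mem hI) hX
  have hσ₀fix : ∀ X : geomPoints W, p • X = 0 → σ₀ • X = X := fun X hX ↦ by
    have hτX : p • (τ • X) = 0 := by rw [smul_comm, hX, smul_zero]
    have h1 := hγfix (τ • X) hτX
    rw [mul_smul, mul_smul, inv_smul_smul] at h1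
    -- `τ • σ₀ • X = τ • X`
    exact smul_left_cancel τ h1
  -- the injective homomorphism `E[p] → Ẽ_v(k_v)`
  let incl : W.geomTorsion p →+ W.geomPrimaryTorsion p :=
    { toFun := fun P ↦ ⟨P, 1, by
        have := AddSubgroup.torsionBy.nsmul_iff.mp P.2
        simpa only [pow_one] using this⟩
      map_zero' := rfl
      map_add' := fun _ _ ↦ rfl }
  have hincl : Function.Injective incl := fun P Q h ↦ by
    apply Subtype.ext
    have := congrArg Subtype.val h
    exact this
  let g : W.geomTorsion p →+ geomPoints Wt := f.comp incl
  have hg : Function.Injective g := hf.comp hincl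
  -- every `g P` is fixed by `φk`, hence `k_v`-rational
  have hgfix : ∀ P : W.geomTorsion p, φk • g P = g P := fun P ↦ by
    have hP : p • (P : geomPoints W) = 0 := AddSubgroup.torsionBy.nsmul_iff.mp P.2
    have h1 : σ₀ • incl P = incl P := by
      apply Subtype.ext
      rw [primaryComponent.coe_smul]
      exact hσ₀fix P hP
    show φk • f (incl P) = f (incl P)
    rw [← hfσ, h1]
  let bc : (Wt.baseChange k).toAffine.Point →+ geomPoints Wt :=
    Affine.Point.baseChange k (AlgebraicClosure k)
  have hbc : Function.Injective bc := Affine.Point.map_injective _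
  have hrange : ∀ P : W.geomTorsion p, g P ∈ bc.range := fun P ↦ by
    obtain ⟨R₀, hR₀⟩ := exists_baseChange_eq_of_frobenius_smul_eq Wt hφk (hgfix P)
    exact ⟨R₀, hR₀⟩
  let g' : W.geomTorsion p →+ bc.range := g.codRestrict bc.range hrange
  let e : (Wt.baseChange k).toAffine.Point ≃+ bc.range := AddMonoidHom.ofInjective hbc
  let h : W.geomTorsion p →+ (Wt.baseChange k).toAffine.Point :=
    e.symm.toAddMonoidHom.comp g'
  have hh : Function.Injective h := by
    refine e.symm.injective.comp ?_
    intro P Q hPQ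
    exact hg (congrArg Subtype.val hPQ)
  -- count
  have hA : Nat.card (W.geomTorsion (p : ℕ)) = p ^ 2 :=
    card_torsionPoints_eq_sq_holds W (AlgebraicClosure ℚ) (n := p) (Nat.cast_ne_zero.mpr hp.ne_zero)
  rw [← hcard, ← hA]
  exact AddSubgroup.card_dvd_of_injective h hh

/-- **Surjectivity of `ρ̄_{E,p}` from ONE Frobenius with irreducible characteristic polynomial and
ONE Frobenius of order `p`.** Let `W/ℚ` be a globally minimal elliptic curve, `p` a prime, `ℓ₁, ℓ₂ ≠ p`
primes of good reduction with: `X² − a_{ℓ₁} X + ℓ₁` irreducible modulo `p` (no root in `𝔽_p`);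
`ℓ₂ ≡ 1 (mod p)`, `a_{ℓ₂} ≡ 2 (mod p)` and `p² ∤ #Ẽ(𝔽_{ℓ₂})`. Then `ρ̄_{E,p} : Γ_ℚ → Aut(E[p])` is
onto. In a trace-compatible frame `Φ : Aut(E[p]) ≅ GL₂(𝔽_p)` with `det ∘ Φ ∘ ρ̄ = χ̄_p` onto
(`exists_frame_galoisRepTorsion_rat`, Serre §5.2 (iii)) let `G` be the image. The Frobenius `φ` at a
prime above `ℓ₂` gives `g = Φ(ρ̄(φ)) ∈ G` with `tr g = a_{ℓ₂} = 2`, `det g = ℓ₂ = 1`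
(`trace_galoisRepTorsion_frobenius_eq`, `Mazur1978.modPCyclotomicCharacterZMod_of_isArithFrobAt`),
so `det(g − 1) = 0`; and `g ≠ 1`, for otherwise `ρ̄(φ) = 1`, `φ` fixes `E[p]` and
`p² ∣ #Ẽ(𝔽_{ℓ₂})` (`sq_dvd_reductionPointCount_of_forall_smul_eq`). Hence `g` has order `p`
(`Serre1972.orderOf_eq_of_det_eq_one_of_det_sub_one_eq_zero`: a transvection), `p ∣ #G`, and by
Serre's Prop. 15 (`eq_top_of_dvd_card_of_forall_ne`: `p ∣ #G`, an element of `G` without eigenvalue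
in `𝔽_p` — the Frobenius at `ℓ₁` — and `det` onto) `G = GL₂(𝔽_p)`, i.e. `Surj`
(`map_range_galoisRepTorsion_eq_top_iff`). [cite: Serre1972, §2.4 Prop. 15, §2.8 Prop. 19 a), §5.2 (iii)]
[cite: Mazur1978, §6 Prop. 6.3 (1) (p. 153)] -/
theorem hasSurjectiveModNGaloisRep_of_irr_of_order (W : WeierstrassCurve ℚ) [W.IsElliptic]
    [W.IsGloballyMinimal] (p : ℕ) [Fact p.Prime]
    (ℓ₁ ℓ₂ : ℕ) [Fact ℓ₁.Prime] [Fact ℓ₂.Prime] (h₁ : ℓ₁ ≠ p) (h₂ : ℓ₂ ≠ p)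
    (hg₁ : W.HasGoodReductionAtPrime ℓ₁) (hg₂ : W.HasGoodReductionAtPrime ℓ₂)
    (hirr : ∀ c : ZMod p, c ^ 2 - (W.frobeniusTrace ℓ₁ : ZMod p) * c + ℓ₁ ≠ 0)
    (hdet₂ : (ℓ₂ : ZMod p) = 1) (htr₂ : (W.frobeniusTrace ℓ₂ : ZMod p) = 2)
    (hsq : ¬ p ^ 2 ∣ W.reductionPointCount ℓ₂) :
    W.HasSurjectiveModNGaloisRep p := by
  letI : Module (ZMod p) (geomTorsion W p) := AddSubgroup.torsionBy.zmodModule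
  have hp : p.Prime := Fact.out
  have hℓ₂ : ℓ₂.Prime := Fact.out
  obtain ⟨e, Φ, -, hΦ, hdet, hdetsurj, -⟩ := W.exists_frame_galoisRepTorsion_rat p
  rw [← map_range_galoisRepTorsion_eq_top_iff W p Φ]
  set G := (galoisRepTorsion W p).range.map Φ.toMonoidHom with hG
  -- the irreducibility witness
  obtain ⟨s, hs, hts, hds⟩ := exists_mem_image_trace_eq_det_eq W p Φ hΦ hdet ℓ₁ h₁ hg₁
  -- the order-`p` witness: a Frobenius `φ` at a prime above `ℓ₂`
  set v : HeightOneSpectrum (𝓞 ℚ) := (Rat.HeightOneSpectrum.primesEquiv (R := 𝓞 ℚ)).symm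
    ⟨ℓ₂, hℓ₂⟩ with hvdef
  have hvℓ : (Rat.HeightOneSpectrum.primesEquiv v : ℕ) = ℓ₂ := by
    rw [hvdef, Equiv.apply_symm_apply]
  have hv : (ℓ₂ : 𝓞 ℚ) ∈ v.asIdeal := by
    rw [DeuringLadic.natCast_mem_asIdeal_iff v ℓ₂, hvℓ]
  obtain ⟨𝔓, h𝔓⟩ := v.primesAbove_nonempty
  obtain ⟨φ, hφ⟩ := HeightOneSpectrum.exists_isArithFrobAt_of_mem_primesAbove_holds (v := v) h𝔓
  set g : GL (Fin 2) (ZMod p) := Φ (galoisRepTorsion W p φ) with hgdef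
  have hgG : g ∈ G := apply_galoisRepTorsion_mem_map_range W p Φ φ
  have htrg : (g : Matrix (Fin 2) (Fin 2) (ZMod p)).trace = 2 := by
    rw [hgdef, hΦ, W.trace_galoisRepTorsion_frobenius_eq p h₂ hg₂ hvℓ h𝔓 hφ, htr₂]
  have hdetg : Matrix.GeneralLinearGroup.det g = 1 := by
    apply Units.ext
    rw [hgdef, hdet, Mazur1978.modPCyclotomicCharacterZMod_of_isArithFrobAt p ℓ₂ h₂ hv h𝔓 hφ,
      Units.val_one, hdet₂]
  have hsing : ((g : Matrix (Fin 2) (Fin 2) (ZMod p)) - 1).det = 0 := by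
    rw [det_sub_one_fin_two, ← Matrix.GeneralLinearGroup.val_det_apply, hdetg, Units.val_one, htrg]
    ring
  have hne : g ≠ 1 := by
    intro hg1
    apply hsq
    -- `ρ̄(φ) = 1`, i.e. `φ` acts trivially on `E[p]`
    have hρ : galoisRepTorsion W p φ = 1 := by
      apply Φ.injective
      rw [map_one]; exact hg1
    refine sq_dvd_reductionPointCount_of_forall_smul_eq W p ℓ₂ h₂ hg₂ hv h𝔓 hφ fun P ↦ ?_
    have h1 : (galoisRepTorsion W p φ).toAdd P = P := by rw [hρ]; rfl
    exact h1
  have horder : orderOf g = p := orderOf_eq_of_det_eq_one_of_det_sub_one_eq_zero hdetg hne hsing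
  have hpG : p ∣ Nat.card G := dvd_natCard_of_mem_of_orderOf_eq hgG horder
  refine eq_top_of_dvd_card_of_forall_ne G hpG hs ?_ fun u ↦ ?_
  · intro c
    rw [hts, hds]
    exact hirr c
  · obtain ⟨σ, hσ⟩ := hdetsurj u
    exact ⟨Φ (galoisRepTorsion W p σ), apply_galoisRepTorsion_mem_map_range W p Φ σ, hσ⟩

/-- `#Ẽ(𝔽_ℓ) = #(E₀ mod ℓ)(𝔽_ℓ)` for the integral model `E₀ = integralModelInt W` (the tree's
`reductionPointCount` is by definition the point count of the reduction of the minimal integral model).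
[folklore] -/
theorem reductionPointCount_eq_of_intModel {W : WeierstrassCurve ℚ} [W.IsGloballyMinimal]
    {E₀ : WeierstrassCurve ℤ} (hI : integralModelInt W = E₀) (ℓ : ℕ) :
    W.reductionPointCount ℓ = Nat.card ((E₀.map (Int.castRingHom (ZMod ℓ))).toAffine.Point) := by
  rw [WeierstrassCurve.reductionPointCount, hI]

/-- **Surjectivity of `ρ̄_{E,p}` READ OFF AN INTEGER MODEL from two point counts**: as
`hasSurjectiveModNGaloisRep_of_irr_of_order` with `integralModelInt W = E₀`, good reduction from
`ℓᵢ ∤ Δ(E₀)`, traces `a_{ℓᵢ} = ℓᵢ + 1 − nᵢ` and `#Ẽ(𝔽_{ℓ₂}) = n₂` from kernel point counts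
`#(E₀ mod ℓᵢ)(𝔽_{ℓᵢ}) = nᵢ`; the witness conditions are decidable: `∀ c : 𝔽_p, c² − a₁ c + ℓ₁ ≠ 0`,
`ℓ₂ = 1` and `a₂ = 2` in `𝔽_p`, `p² ∤ n₂`. At `p = 3`: `ℓ₂ ≡ 1 (mod 3)`, `3 ∣ n₂`, `9 ∤ n₂`.
[cite: Serre1972, §2.4 Prop. 15, §2.8 Prop. 19 a), §5.2 (iii)] -/
theorem hasSurjectiveModNGaloisRep_of_intModel_of_irr_of_order {W : WeierstrassCurve ℚ}
    [W.IsElliptic] [W.IsGloballyMinimal] {E₀ : WeierstrassCurve ℤ} (hI : integralModelInt W = E₀)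
    (p : ℕ) [Fact p.Prime] (ℓ₁ ℓ₂ : ℕ) [Fact ℓ₁.Prime] [Fact ℓ₂.Prime] (h₁ : ℓ₁ ≠ p) (h₂ : ℓ₂ ≠ p)
    (hΔ₁ : ¬ (ℓ₁ : ℤ) ∣ E₀.Δ) (hΔ₂ : ¬ (ℓ₂ : ℤ) ∣ E₀.Δ) {n₁ n₂ : ℕ}
    (hc₁ : Nat.card ((E₀.map (Int.castRingHom (ZMod ℓ₁))).toAffine.Point) = n₁)
    (hc₂ : Nat.card ((E₀.map (Int.castRingHom (ZMod ℓ₂))).toAffine.Point) = n₂)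
    (hirr : ∀ c : ZMod p, c ^ 2 - (((ℓ₁ : ℤ) + 1 - n₁ : ℤ) : ZMod p) * c + ℓ₁ ≠ 0)
    (hdet₂ : (ℓ₂ : ZMod p) = 1) (htr₂ : (((ℓ₂ : ℤ) + 1 - n₂ : ℤ) : ZMod p) = 2)
    (hsq : ¬ p ^ 2 ∣ n₂) :
    W.HasSurjectiveModNGaloisRep p := by
  have hg : ∀ (ℓ : ℕ) [Fact ℓ.Prime], ¬ (ℓ : ℤ) ∣ E₀.Δ → W.HasGoodReductionAtPrime ℓ :=
    fun ℓ _ h ↦ hasGoodReductionAtPrime_of_not_dvd W ℓ (by rw [minimalDiscriminantInt_eq hI]; exact h)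
  refine hasSurjectiveModNGaloisRep_of_irr_of_order W p ℓ₁ ℓ₂ h₁ h₂ (hg ℓ₁ hΔ₁) (hg ℓ₂ hΔ₂) ?_ hdet₂
    ?_ ?_
  · rw [frobeniusTrace_eq hI hc₁]; exact hirr
  · rw [frobeniusTrace_eq hI hc₂]; exact htr₂
  · rw [reductionPointCount_eq_of_intModel hI, hc₂]; exact hsq

end Summit.BirchSwinnertonDyer.Rank1Residual.GaloisImage

end
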